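import Summits.MatrixMultiplication.OmegaCensus.SmallFormats.MatMul22nRankGF5XCapParityChecks2
import HarnessLib

/-!
# ω-census family (a): `decide` checks of the rectangle-parity identities of the X-cap system over `𝔽₅` (part 3: rectangles `150 … 224`)

Cell `pub-omega` (unit `pub-omega-tensor-g11`), topic `Summits/MatrixMultiplication/OmegaCensus` (sub-folder `SmallFormats`).
Framing (verbatim): lottery ticket; floor = certified bounds/negative ranges. HONEST FRAMING: machine checks of DATA
(`MatMul22nRankGF5XCapParityData`), no mathematics: for the rectangles `i` of this part and every variable `j < 157`, the multipliers
`cp5 i − cm5 i` on the tangent rows combine the columns of `xcapSys5` into `2·ps5 i j + [j is one of the four rank-one classes of the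
rectangle] + 4·[j = 156]` (`parId5`). Chunks of 15 rectangles per `decide` (kernel memory). Consumer: the parity lemma
`MatMul22nRankGF5XCapParity`. Nothing here is progress on `ω`.
-/

namespace Summit.MatrixMultiplication.OmegaCensus.SmallFormats

set_option maxRecDepth 100000 in
set_option maxHeartbeats 4000000 in
/-- Column identities, rectangles `150 … 164`. -/
theorem parId5_c10 : ∀ i : Fin 225, 150 ≤ i.val → i.val < 165 → ∀ j : Fin 157, parId5 i.val j.val := by decide +kernel

set_option maxRecDepth 100000 in
set_option maxHeartbeats 4000000 in
/-- Column identities, rectangles `165 … 179`. -/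
theorem parId5_c11 : ∀ i : Fin 225, 165 ≤ i.val → i.val < 180 → ∀ j : Fin 157, parId5 i.val j.val := by decide +kernel

set_option maxRecDepth 100000 in
set_option maxHeartbeats 4000000 in
/-- Column identities, rectangles `180 … 194`. -/
theorem parId5_c12 : ∀ i : Fin 225, 180 ≤ i.val → i.val < 195 → ∀ j : Fin 157, parId5 i.val j.val := by decide +kernel

set_option maxRecDepth 100000 in
set_option maxHeartbeats 4000000 in
/-- Column identities, rectangles `195 … 209`. -/
theorem parId5_c13 : ∀ i : Fin 225, 195 ≤ i.val → i.val < 210 → ∀ j : Fin 157, parId5 i.val j.val := by decide +kernel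

set_option maxRecDepth 100000 in
set_option maxHeartbeats 4000000 in
/-- Column identities, rectangles `210 … 224`. -/
theorem parId5_c14 : ∀ i : Fin 225, 210 ≤ i.val → ∀ j : Fin 157, parId5 i.val j.val := by decide +kernel

end Summit.MatrixMultiplication.OmegaCensus.SmallFormats
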